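import Summits.CriticalPhenomena.PercolationContinuityZ3.Theorems.PercNearOneGluingNoHeavyLowerTailSourceRepellerExchange
import Summits.CriticalPhenomena.PercolationContinuityZ3.Theorems.PercNearOneGluingAdditiveGluingBhkMenu
import HarnessLib

/-!
# `NoHeavyLowerTail` (stmt-CriticalPhenomena-4575) — the free-second-source rows of the G-split (`S_F`, `Fex` at `φ^{N1}`)
# (depth prover `nh-dp-commonrelay`, gen 9)

Support file (`--supports stmt-CriticalPhenomena-4575`); no definitions, no named facts, no sorries.  Notation as in
`…SourceRepellerExchange`: `R = {a₁ ↮ a₃}`, `N₁ = {a₁ ↮ a₂, a₃}`, `J = {a₁↔a₂}`, `B = {a₁↔b}`, `T = {a₃↔b}`,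
`F1 := N₁ ∩ {a₂↔o}` ("the second source is free of the source and the observer sits in its cluster"; `C(a₂)` may contain
the repeller), `φ^{N1} := μ(N₁ ∩ {a₂↔o})/μ(N₁)`.

THE G-SPLIT (memo RESIDUAL-gen9.md §3).  On `R`, `1{o∈C(a₁)} = 1_{E♭} − 1_{F1} + 1_G` with `E♭ = {a₁↔o} ∪ ({a₂↔o} ∩ {a₂↮a₃})`
and `G = {o, a₂ ∈ C(a₃)}`; the registered hypothesis-free rows (K\*g), (K\*t), (Y13) of this line then split into an `E♭`-part
(repeller frame: `sre_exchangeEflat`, `sre_covEflatSource/Repeller`, PROVED), an `F1`-part (this file, PROVED) and the single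
adverse BHK-1.5 term in `G`.  This file proves the three `F1`-rows at the constant `φ^{N1}`, each from ONE van den Berg–Häggström–Kahn
inequality on `N₁` plus bookkeeping:

* `fse_SF_source`:   `μ(N₁)·(μ(F1) μ(R∩B) − μ(F1∩B) μ(R)) ≥ μ(F1)·(μ(R∩J∩B) μ(R) − μ(R∩J) μ(R∩B))`,
  i.e. `−Cov(1_{F1}, 1_B | R) ≥ φ^{N1}·Cov(1_J, 1_B | R)`   [BHK Thm 1.4 on `N₁`: `{a₁↔b}` vs `{a₂↔o}`];
* `fse_SF_repeller`: `μ(N₁)·(μ(F1∩T) μ(R) − μ(F1) μ(R∩T)) ≥ μ(F1)·(μ(R∩J) μ(R∩T) − μ(R∩J∩T) μ(R))`,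
  i.e. `Cov(1_{F1}, 1_T | R) ≥ −φ^{N1}·Cov(1_J, 1_T | R)`  [BHK Thm 1.3 for the set `{a₂,a₃}` given `{a₂,a₃} ↮ a₁`];
* `fse_Fex0`:        `μ(N₁)·(μ(F1∩T) μ(R∩B) − μ(F1∩B) μ(R∩T)) ≥ μ(F1)·(μ(R∩J∩B) μ(R∩T) − μ(R∩J∩T) μ(R∩B))`,
  i.e. `E[1_{F1} + φ^{N1}1_J | R, T] ≥ E[1_{F1} + φ^{N1}1_J | R, B]`  [both].
Since `φ₂ ≤ φ^M ≤ φ^{N1}` (KN Lemma 1(i) and BHK Thm 1.3) and `Cov(J,B|R) ≥ 0 ≥ Cov(J,T|R)` (BHK Thms 1.3/1.5), the same rows hold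
with `φ₂ = μ(N₂∩{a₂↔o})/μ(N₂)` in place of `φ^{N1}` (not needed here).  Numerically these are also valid LP rows for the U13
certificate programme (ineq-harness crl9-Fex0).
[cite: VandenbergHaggstromKahn2005, Thm. 1.3 (p. 6), Thm. 1.4 (p. 7); KozmaNitzan2024, Lemma 1 (pp. 5–6), Question 7 (p. 36)]
-/

namespace Summit.CriticalPhenomena.PercolationContinuityZ3.Theorems

open MeasureTheory Set Literature.Probability.LatticeModels Literature.Probability.Percolation

noncomputable section

open Classical

variable {n : ℕ}

/-! ### Set bookkeeping -/

/-- `{S ↮ X} = N₁` for the source SET `S = {a₂, a₃}` and `X = {a₁}`. [folklore] -/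
theorem fse_sep_pair_set (a₁ a₂ a₃ : Fin n) :
    {ω : BondConfig (Fin n) | ∀ s ∈ ({a₂, a₃} : Finset (Fin n)), ∀ x ∈ ({a₁} : Set (Fin n)),
        ¬ (openGraph ω).Reachable s x} = (openConn a₁ a₂)ᶜ ∩ (openConn a₁ a₃)ᶜ := by
  ext ω
  simp only [Finset.mem_insert, Finset.mem_singleton, Set.mem_singleton_iff, forall_eq_or_imp, forall_eq,
    Set.mem_setOf_eq, Set.mem_inter_iff, Set.mem_compl_iff, knThm2_mem_openConn]
  exact ⟨fun ⟨h2, h3⟩ => ⟨fun h => h2 h.symm, fun h => h3 h.symm⟩, fun ⟨h2, h3⟩ => ⟨fun h => h2 h.symm, fun h => h3 h.symm⟩⟩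

/-- `(R ∩ T) ∩ J = R ∩ (J ∩ T)`. [folklore] -/
theorem fse_set_RT_J (b a₁ a₂ a₃ : Fin n) :
    (((openConn a₁ a₃)ᶜ ∩ openConn a₃ b) ∩ openConn a₁ a₂ : Set (BondConfig (Fin n))) =
      (openConn a₁ a₃)ᶜ ∩ (openConn a₁ a₂ ∩ openConn a₃ b) := by
  ext ω
  simp only [Set.mem_inter_iff, Set.mem_compl_iff]
  tauto

/-- `(R ∩ T) \ J = N₁ ∩ T`. [folklore] -/
theorem fse_set_RT_Jc (b a₁ a₂ a₃ : Fin n) :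
    (((openConn a₁ a₃)ᶜ ∩ openConn a₃ b) \ openConn a₁ a₂ : Set (BondConfig (Fin n))) =
      (openConn a₁ a₂)ᶜ ∩ (openConn a₁ a₃)ᶜ ∩ openConn a₃ b := by
  ext ω
  simp only [Set.mem_sdiff, Set.mem_inter_iff, Set.mem_compl_iff]
  tauto

/-- `R \ J = N₁`. [folklore] -/
theorem fse_set_R_Jc (a₁ a₂ a₃ : Fin n) :
    ((openConn a₁ a₃)ᶜ \ openConn a₁ a₂ : Set (BondConfig (Fin n))) = (openConn a₁ a₂)ᶜ ∩ (openConn a₁ a₃)ᶜ := by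
  ext ω
  simp only [Set.mem_sdiff, Set.mem_inter_iff, Set.mem_compl_iff]
  tauto

/-- `N₁ ∩ (B ∩ O₂) = (N₁ ∩ O₂) ∩ B`. [folklore] -/
theorem fse_set_N1_BO (o b a₁ a₂ a₃ : Fin n) :
    ((openConn a₁ a₂)ᶜ ∩ (openConn a₁ a₃)ᶜ ∩ (openConn a₁ b ∩ openConn a₂ o) : Set (BondConfig (Fin n))) =
      (openConn a₁ a₂)ᶜ ∩ (openConn a₁ a₃)ᶜ ∩ openConn a₂ o ∩ openConn a₁ b := by
  ext ω
  simp only [Set.mem_inter_iff, Set.mem_compl_iff]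
  tauto

/-- `N₁ ∩ (O₂ ∩ T) = (N₁ ∩ O₂) ∩ T`. [folklore] -/
theorem fse_set_N1_OT (o b a₁ a₂ a₃ : Fin n) :
    ((openConn a₁ a₂)ᶜ ∩ (openConn a₁ a₃)ᶜ ∩ (openConn a₂ o ∩ openConn a₃ b) : Set (BondConfig (Fin n))) =
      (openConn a₁ a₂)ᶜ ∩ (openConn a₁ a₃)ᶜ ∩ openConn a₂ o ∩ openConn a₃ b := by
  ext ω
  simp only [Set.mem_inter_iff, Set.mem_compl_iff]
  tauto

/-! ### The two BHK inputs on `N₁` -/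

/-- **BHK Thm 1.4 on `N₁`: `μ(N₁) μ(N₁ ∩ O₂ ∩ B) ≤ μ(N₁ ∩ B) μ(N₁ ∩ O₂)`** — given `a₁ ↮ {a₂,a₃}`, the source's event
`{a₁↔b}` and the second source's event `{a₂↔o}` (increasing in `C({a₂,a₃})`) are negatively correlated.
[cite: VandenbergHaggstromKahn2005, Thm. 1.4 (p. 7)] -/
theorem fse_bhkB (w : Sym2 (Fin n) → unitInterval) (o b a₁ a₂ a₃ : Fin n) (h12 : a₁ ≠ a₂) (h13 : a₁ ≠ a₃) :
    (prodBernoulli w).real ((openConn a₁ a₂)ᶜ ∩ (openConn a₁ a₃)ᶜ : Set (BondConfig (Fin n))) *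
        (prodBernoulli w).real ((openConn a₁ a₂)ᶜ ∩ (openConn a₁ a₃)ᶜ ∩ openConn a₂ o ∩ openConn a₁ b) ≤
      (prodBernoulli w).real ((openConn a₁ a₂)ᶜ ∩ (openConn a₁ a₃)ᶜ ∩ openConn a₁ b) *
        (prodBernoulli w).real ((openConn a₁ a₂)ᶜ ∩ (openConn a₁ a₃)ᶜ ∩ openConn a₂ o) := by
  have hdis : Disjoint ({a₁} : Finset (Fin n)) {a₂, a₃} := by
    simp only [Finset.disjoint_singleton_left, Finset.mem_insert, Finset.mem_singleton, not_or]
    exact ⟨h12, h13⟩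
  have i2 := obs_bhkCross w {a₁} {a₂, a₃} b (x := a₂) (by simp) o hdis
  rw [knThm2_sep_single_finset, Finset.set_biUnion_singleton, fse_set_N1_BO] at i2
  exact i2

/-- **BHK Thm 1.3 for the set `{a₂,a₃}` given `{a₂,a₃} ↮ a₁`: `μ(N₁ ∩ O₂) μ(N₁ ∩ T) ≤ μ(N₁) μ(N₁ ∩ O₂ ∩ T)`** —
`{a₂↔o}` and `{a₃↔b}` are both increasing in `C({a₂,a₃})`, hence positively correlated on `N₁`.
[cite: VandenbergHaggstromKahn2005, Thm. 1.3 (p. 6)] -/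
theorem fse_bhkT (w : Sym2 (Fin n) → unitInterval) (o b a₁ a₂ a₃ : Fin n) (h12 : a₁ ≠ a₂) (h13 : a₁ ≠ a₃) :
    (prodBernoulli w).real ((openConn a₁ a₂)ᶜ ∩ (openConn a₁ a₃)ᶜ ∩ openConn a₂ o) *
        (prodBernoulli w).real ((openConn a₁ a₂)ᶜ ∩ (openConn a₁ a₃)ᶜ ∩ openConn a₃ b) ≤
      (prodBernoulli w).real ((openConn a₁ a₂)ᶜ ∩ (openConn a₁ a₃)ᶜ : Set (BondConfig (Fin n))) *
        (prodBernoulli w).real ((openConn a₁ a₂)ᶜ ∩ (openConn a₁ a₃)ᶜ ∩ openConn a₂ o ∩ openConn a₃ b) := by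
  have hSX : ∀ s ∈ ({a₂, a₃} : Finset (Fin n)), s ∉ ({a₁} : Set (Fin n)) := by
    intro s hs
    simp only [Finset.mem_insert, Finset.mem_singleton] at hs
    simp only [Set.mem_singleton_iff]
    rcases hs with rfl | rfl
    · exact fun h => h12 h.symm
    · exact fun h => h13 h.symm
  have key := bhkMenu_one stub_bhkSets.1 w ({a₂, a₃} : Finset (Fin n)) ({a₁} : Set (Fin n))
    {C : Set (Sym2 (Fin n)) | (openGraph C).Reachable a₂ o} {C : Set (Sym2 (Fin n)) | (openGraph C).Reachable a₃ b}
    (bhkMenu_pt_isUpperSet a₂ o) (bhkMenu_pt_isUpperSet a₃ b)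
    (openConn a₂ o) (openConn a₃ b)
    (fun ω => bhkMenu_pt_mem {a₂, a₃} (by simp) o ω) (fun ω => bhkMenu_pt_mem {a₂, a₃} (by simp) b ω) hSX
  rw [fse_sep_pair_set, fse_set_N1_OT] at key
  exact key

/-! ### The three rows -/

/-- **`S_F` row, source side: `−Cov(1_{F1}, 1_B | R) ≥ φ^{N1} Cov(1_J, 1_B | R)`, division-free:**
`μ(N₁)·(μ(N₁∩O₂) μ(R∩B) − μ(N₁∩O₂∩B) μ(R)) ≥ μ(N₁∩O₂)·(μ(R∩J∩B) μ(R) − μ(R∩J) μ(R∩B))`.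
Proof: `fse_bhkB` and the splittings `μ(R∩B) = μ(N₁∩B) + μ(R∩J∩B)`, `μ(R) = μ(N₁) + μ(R∩J)`; the rest cancels exactly.
[cite: VandenbergHaggstromKahn2005, Thm. 1.4 (p. 7)] -/
theorem fse_SF_source (w : Sym2 (Fin n) → unitInterval) (o b a₁ a₂ a₃ : Fin n) (h12 : a₁ ≠ a₂) (h13 : a₁ ≠ a₃) :
    (prodBernoulli w).real ((openConn a₁ a₂)ᶜ ∩ (openConn a₁ a₃)ᶜ ∩ openConn a₂ o) *
        ((prodBernoulli w).real ((openConn a₁ a₃)ᶜ ∩ (openConn a₁ a₂ ∩ openConn a₁ b)) *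
            (prodBernoulli w).real ((openConn a₁ a₃)ᶜ : Set (BondConfig (Fin n))) -
          (prodBernoulli w).real ((openConn a₁ a₃)ᶜ ∩ openConn a₁ a₂) *
            (prodBernoulli w).real ((openConn a₁ a₃)ᶜ ∩ openConn a₁ b)) ≤
      (prodBernoulli w).real ((openConn a₁ a₂)ᶜ ∩ (openConn a₁ a₃)ᶜ : Set (BondConfig (Fin n))) *
        ((prodBernoulli w).real ((openConn a₁ a₂)ᶜ ∩ (openConn a₁ a₃)ᶜ ∩ openConn a₂ o) *
            (prodBernoulli w).real ((openConn a₁ a₃)ᶜ ∩ openConn a₁ b) -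
          (prodBernoulli w).real ((openConn a₁ a₂)ᶜ ∩ (openConn a₁ a₃)ᶜ ∩ openConn a₂ o ∩ openConn a₁ b) *
            (prodBernoulli w).real ((openConn a₁ a₃)ᶜ : Set (BondConfig (Fin n)))) := by
  have hm : ∀ s : Set (BondConfig (Fin n)), MeasurableSet s := fun _ => MeasurableSet.of_discrete
  have hB := fse_bhkB w o b a₁ a₂ a₃ h12 h13
  -- μ(R∩B) = μ(R∩J∩B) + μ(N₁∩B)
  have hs2 := measureReal_inter_add_sdiff (μ := prodBernoulli w)
    (s := ((openConn a₁ a₃)ᶜ ∩ openConn a₁ b : Set (BondConfig (Fin n)))) (hm (openConn a₁ a₂))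
  rw [sre_set_RB_J, sre_set_RB_Jc] at hs2
  -- μ(R) = μ(R∩J) + μ(N₁)
  have hs0 := measureReal_inter_add_sdiff (μ := prodBernoulli w)
    (s := ((openConn a₁ a₃)ᶜ : Set (BondConfig (Fin n)))) (hm (openConn a₁ a₂))
  rw [fse_set_R_Jc] at hs0
  set P1 := (prodBernoulli w).real ((openConn a₁ a₂)ᶜ ∩ (openConn a₁ a₃)ᶜ : Set (BondConfig (Fin n))) with hP1
  set F := (prodBernoulli w).real ((openConn a₁ a₂)ᶜ ∩ (openConn a₁ a₃)ᶜ ∩ openConn a₂ o) with hF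
  set FB := (prodBernoulli w).real ((openConn a₁ a₂)ᶜ ∩ (openConn a₁ a₃)ᶜ ∩ openConn a₂ o ∩ openConn a₁ b) with hFB
  set NB := (prodBernoulli w).real ((openConn a₁ a₂)ᶜ ∩ (openConn a₁ a₃)ᶜ ∩ openConn a₁ b) with hNB
  set muR := (prodBernoulli w).real ((openConn a₁ a₃)ᶜ : Set (BondConfig (Fin n))) with hmuR
  set g1 := (prodBernoulli w).real ((openConn a₁ a₃)ᶜ ∩ openConn a₁ b) with hg1
  set J1 := (prodBernoulli w).real ((openConn a₁ a₃)ᶜ ∩ (openConn a₁ a₂ ∩ openConn a₁ b)) with hJ1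
  set RJ := (prodBernoulli w).real ((openConn a₁ a₃)ᶜ ∩ openConn a₁ a₂) with hRJ
  have hF0 : 0 ≤ F := measureReal_nonneg
  have hR0 : 0 ≤ muR := measureReal_nonneg
  have e1 : g1 = J1 + NB := hs2.symm
  have e2 : muR = RJ + P1 := hs0.symm
  -- F·(J1·muR − RJ·g1) ≤ P1·(F·g1 − FB·muR)  ⟸  P1·FB ≤ NB·F
  have hkey : P1 * (F * g1 - FB * muR) - F * (J1 * muR - RJ * g1) = muR * (NB * F - P1 * FB) := by
    rw [e1, e2]; ring
  have hpos : 0 ≤ muR * (NB * F - P1 * FB) := mul_nonneg hR0 (by linarith [hB])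
  linarith [hkey, hpos]

/-- **`S_F` row, repeller side: `Cov(1_{F1}, 1_T | R) ≥ −φ^{N1} Cov(1_J, 1_T | R)`, division-free:**
`μ(N₁)·(μ(N₁∩O₂∩T) μ(R) − μ(N₁∩O₂) μ(R∩T)) ≥ μ(N₁∩O₂)·(μ(R∩J) μ(R∩T) − μ(R∩J∩T) μ(R))`.
Proof: `fse_bhkT` and the splittings along `J`; the rest cancels exactly.
[cite: VandenbergHaggstromKahn2005, Thm. 1.3 (p. 6)] -/
theorem fse_SF_repeller (w : Sym2 (Fin n) → unitInterval) (o b a₁ a₂ a₃ : Fin n) (h12 : a₁ ≠ a₂) (h13 : a₁ ≠ a₃) :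
    (prodBernoulli w).real ((openConn a₁ a₂)ᶜ ∩ (openConn a₁ a₃)ᶜ ∩ openConn a₂ o) *
        ((prodBernoulli w).real ((openConn a₁ a₃)ᶜ ∩ openConn a₁ a₂) *
            (prodBernoulli w).real ((openConn a₁ a₃)ᶜ ∩ openConn a₃ b) -
          (prodBernoulli w).real ((openConn a₁ a₃)ᶜ ∩ (openConn a₁ a₂ ∩ openConn a₃ b)) *
            (prodBernoulli w).real ((openConn a₁ a₃)ᶜ : Set (BondConfig (Fin n)))) ≤
      (prodBernoulli w).real ((openConn a₁ a₂)ᶜ ∩ (openConn a₁ a₃)ᶜ : Set (BondConfig (Fin n))) *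
        ((prodBernoulli w).real ((openConn a₁ a₂)ᶜ ∩ (openConn a₁ a₃)ᶜ ∩ openConn a₂ o ∩ openConn a₃ b) *
            (prodBernoulli w).real ((openConn a₁ a₃)ᶜ : Set (BondConfig (Fin n))) -
          (prodBernoulli w).real ((openConn a₁ a₂)ᶜ ∩ (openConn a₁ a₃)ᶜ ∩ openConn a₂ o) *
            (prodBernoulli w).real ((openConn a₁ a₃)ᶜ ∩ openConn a₃ b)) := by
  have hm : ∀ s : Set (BondConfig (Fin n)), MeasurableSet s := fun _ => MeasurableSet.of_discrete
  have hT := fse_bhkT w o b a₁ a₂ a₃ h12 h13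
  -- μ(R∩T) = μ(R∩J∩T) + μ(N₁∩T)
  have hs3 := measureReal_inter_add_sdiff (μ := prodBernoulli w)
    (s := ((openConn a₁ a₃)ᶜ ∩ openConn a₃ b : Set (BondConfig (Fin n)))) (hm (openConn a₁ a₂))
  rw [fse_set_RT_J, fse_set_RT_Jc] at hs3
  -- μ(R) = μ(R∩J) + μ(N₁)
  have hs0 := measureReal_inter_add_sdiff (μ := prodBernoulli w)
    (s := ((openConn a₁ a₃)ᶜ : Set (BondConfig (Fin n)))) (hm (openConn a₁ a₂))
  rw [fse_set_R_Jc] at hs0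
  set P1 := (prodBernoulli w).real ((openConn a₁ a₂)ᶜ ∩ (openConn a₁ a₃)ᶜ : Set (BondConfig (Fin n))) with hP1
  set F := (prodBernoulli w).real ((openConn a₁ a₂)ᶜ ∩ (openConn a₁ a₃)ᶜ ∩ openConn a₂ o) with hF
  set FT := (prodBernoulli w).real ((openConn a₁ a₂)ᶜ ∩ (openConn a₁ a₃)ᶜ ∩ openConn a₂ o ∩ openConn a₃ b) with hFT
  set NT := (prodBernoulli w).real ((openConn a₁ a₂)ᶜ ∩ (openConn a₁ a₃)ᶜ ∩ openConn a₃ b) with hNT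
  set muR := (prodBernoulli w).real ((openConn a₁ a₃)ᶜ : Set (BondConfig (Fin n))) with hmuR
  set g3 := (prodBernoulli w).real ((openConn a₁ a₃)ᶜ ∩ openConn a₃ b) with hg3
  set J3 := (prodBernoulli w).real ((openConn a₁ a₃)ᶜ ∩ (openConn a₁ a₂ ∩ openConn a₃ b)) with hJ3
  set RJ := (prodBernoulli w).real ((openConn a₁ a₃)ᶜ ∩ openConn a₁ a₂) with hRJ
  have hR0 : 0 ≤ muR := measureReal_nonneg
  have e1 : g3 = J3 + NT := hs3.symm
  have e2 : muR = RJ + P1 := hs0.symm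
  have hkey : P1 * (FT * muR - F * g3) - F * (RJ * g3 - J3 * muR) = muR * (P1 * FT - F * NT) := by
    rw [e1, e2]; ring
  have hpos : 0 ≤ muR * (P1 * FT - F * NT) := mul_nonneg hR0 (by linarith [hT])
  linarith [hkey, hpos]

/-- **The F-exchange at `φ^{N1}` (`Fex0 ≥ 0`): `E[1_{F1} + φ^{N1}1_J | R, a₃↔b] ≥ φ^{N1} ≥ E[1_{F1} + φ^{N1}1_J | R, a₁↔b]`,
division-free in one line:**
`μ(N₁)·(μ(N₁∩O₂∩T) μ(R∩B) − μ(N₁∩O₂∩B) μ(R∩T)) ≥ μ(N₁∩O₂)·(μ(R∩J∩B) μ(R∩T) − μ(R∩J∩T) μ(R∩B))`.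
Proof: `fse_bhkB`, `fse_bhkT` and the splittings along `J`; the rest cancels exactly.  (Moving `b` from the source's to the
repeller's cluster raises the free-second-source attachment of the observer by at least `φ^{N1}` times the drop of `{a₁↔a₂}`.)
[cite: VandenbergHaggstromKahn2005, Thms. 1.3–1.4 (pp. 6–7)] -/
theorem fse_Fex0 (w : Sym2 (Fin n) → unitInterval) (o b a₁ a₂ a₃ : Fin n) (h12 : a₁ ≠ a₂) (h13 : a₁ ≠ a₃) :
    (prodBernoulli w).real ((openConn a₁ a₂)ᶜ ∩ (openConn a₁ a₃)ᶜ ∩ openConn a₂ o) *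
        ((prodBernoulli w).real ((openConn a₁ a₃)ᶜ ∩ (openConn a₁ a₂ ∩ openConn a₁ b)) *
            (prodBernoulli w).real ((openConn a₁ a₃)ᶜ ∩ openConn a₃ b) -
          (prodBernoulli w).real ((openConn a₁ a₃)ᶜ ∩ (openConn a₁ a₂ ∩ openConn a₃ b)) *
            (prodBernoulli w).real ((openConn a₁ a₃)ᶜ ∩ openConn a₁ b)) ≤
      (prodBernoulli w).real ((openConn a₁ a₂)ᶜ ∩ (openConn a₁ a₃)ᶜ : Set (BondConfig (Fin n))) *
        ((prodBernoulli w).real ((openConn a₁ a₂)ᶜ ∩ (openConn a₁ a₃)ᶜ ∩ openConn a₂ o ∩ openConn a₃ b) *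
            (prodBernoulli w).real ((openConn a₁ a₃)ᶜ ∩ openConn a₁ b) -
          (prodBernoulli w).real ((openConn a₁ a₂)ᶜ ∩ (openConn a₁ a₃)ᶜ ∩ openConn a₂ o ∩ openConn a₁ b) *
            (prodBernoulli w).real ((openConn a₁ a₃)ᶜ ∩ openConn a₃ b)) := by
  have hm : ∀ s : Set (BondConfig (Fin n)), MeasurableSet s := fun _ => MeasurableSet.of_discrete
  have hB := fse_bhkB w o b a₁ a₂ a₃ h12 h13
  have hT := fse_bhkT w o b a₁ a₂ a₃ h12 h13
  have hs2 := measureReal_inter_add_sdiff (μ := prodBernoulli w)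
    (s := ((openConn a₁ a₃)ᶜ ∩ openConn a₁ b : Set (BondConfig (Fin n)))) (hm (openConn a₁ a₂))
  rw [sre_set_RB_J, sre_set_RB_Jc] at hs2
  have hs3 := measureReal_inter_add_sdiff (μ := prodBernoulli w)
    (s := ((openConn a₁ a₃)ᶜ ∩ openConn a₃ b : Set (BondConfig (Fin n)))) (hm (openConn a₁ a₂))
  rw [fse_set_RT_J, fse_set_RT_Jc] at hs3
  set P1 := (prodBernoulli w).real ((openConn a₁ a₂)ᶜ ∩ (openConn a₁ a₃)ᶜ : Set (BondConfig (Fin n))) with hP1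
  set F := (prodBernoulli w).real ((openConn a₁ a₂)ᶜ ∩ (openConn a₁ a₃)ᶜ ∩ openConn a₂ o) with hF
  set FB := (prodBernoulli w).real ((openConn a₁ a₂)ᶜ ∩ (openConn a₁ a₃)ᶜ ∩ openConn a₂ o ∩ openConn a₁ b) with hFB
  set FT := (prodBernoulli w).real ((openConn a₁ a₂)ᶜ ∩ (openConn a₁ a₃)ᶜ ∩ openConn a₂ o ∩ openConn a₃ b) with hFT
  set NB := (prodBernoulli w).real ((openConn a₁ a₂)ᶜ ∩ (openConn a₁ a₃)ᶜ ∩ openConn a₁ b) with hNB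
  set NT := (prodBernoulli w).real ((openConn a₁ a₂)ᶜ ∩ (openConn a₁ a₃)ᶜ ∩ openConn a₃ b) with hNT
  set g1 := (prodBernoulli w).real ((openConn a₁ a₃)ᶜ ∩ openConn a₁ b) with hg1
  set g3 := (prodBernoulli w).real ((openConn a₁ a₃)ᶜ ∩ openConn a₃ b) with hg3
  set J1 := (prodBernoulli w).real ((openConn a₁ a₃)ᶜ ∩ (openConn a₁ a₂ ∩ openConn a₁ b)) with hJ1
  set J3 := (prodBernoulli w).real ((openConn a₁ a₃)ᶜ ∩ (openConn a₁ a₂ ∩ openConn a₃ b)) with hJ3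
  have hg1 : 0 ≤ g1 := measureReal_nonneg
  have hg3 : 0 ≤ g3 := measureReal_nonneg
  have e1 : g1 = J1 + NB := hs2.symm
  have e3 : g3 = J3 + NT := hs3.symm
  -- P1·(FT·g1 − FB·g3) − F·(J1·g3 − J3·g1) = g1·(P1·FT − F·NT) + g3·(F·NB − P1·FB)
  have hkey : P1 * (FT * g1 - FB * g3) - F * (J1 * g3 - J3 * g1) =
      g1 * (P1 * FT - F * NT) + g3 * (NB * F - P1 * FB) := by
    rw [e1, e3]; ring
  have hp1 : 0 ≤ g1 * (P1 * FT - F * NT) := mul_nonneg hg1 (by linarith [hT])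
  have hp2 : 0 ≤ g3 * (NB * F - P1 * FB) := mul_nonneg hg3 (by linarith [hB])
  linarith [hkey, hp1, hp2]

end

end Summit.CriticalPhenomena.PercolationContinuityZ3.Theorems
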